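import Literature.AnabelianGeometry.EtaleTheta.ThetaSubquotientOfTemperedAut
import Literature.AnabelianGeometry.EtaleTheta.Discharge.Sec4GaloisSurjNaturalModel

/-!
# [EtTh] §5: laws of print's `Aut`-subquotient `autPre ↠ (l·Δ_Θ)_E` — conjugation equivariance, Galois surjections

Mochizuki, *The étale theta function and its Frobenioid-theoretic manifestations*, Publ. RIMS **45** (2009), §5 p. 327
(PDF p. 101): "these subquotients determine subquotients `Aut_D(D) ↠ Aut^Θ_D(D)`; `(l·Δ_Θ)_D ⊆ Aut^Θ_D(D)` which are
preserved by arbitrary self-equivalences of `D`"; proof of Prop. 5.5, p. 328 (PDF p. 102) (transport along linear morphisms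
of Galois coverings is conjugation on the `Aut`-subquotients); Def. 4.1 (ii) p. 313 (PDF p. 87) ("the natural surjective
outer homomorphism `Π^tp_X ↠ Aut_D(B^bs)`").  [cite: MochizukiEtTh2009, §5 p.327–328 (PDF pp.101–102)]

PROOF-ONLY (no definitions).  abc-iut cell, seat abc-iut-w4-d042 (gen 3), row «MERGE-PLAN row 2 (D) autProj +
G-w5d123-2 / G-w4d099-2 AT THE GENUINE (Q,P)» (L2-lead GO 2026-08-26T05:48:05Z).  Over abc-iut-L2-t9's theta subquotients
`(l·Δ_Θ)_E = LDelta q ι E` (`ThetaSubquotientOfTempered.lean`, R2 carrier) and print's `Aut`-subquotient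
`autPre q ι E ≤ Aut E ↠ (l·Δ_Θ)_E` via `autProj` (`ThetaSubquotientOfTemperedAut.lean`):

* **(hproj) conjugation equivariance — the law of GAP-LEDGER G-w4d099-2 at the GENUINE pair `(Q, P) =
  (thetaSubquotientStub q ι, ⟨autPre, autProj⟩)`**: for EVERY connected `E` and EVERY `g ∈ Aut E`, `autPre E` is normalised
  by `g` (`conj_mem_autPre`, `autPre_normal`) and the transport of `(l·Δ_Θ)_E` along `g` is conjugation through `autProj`
  (`map_autProj_eq_autProj_conj`; existential binder shape of abc-iut-w5-d020's p420788 / abc-iut-w4-d099's p425830: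
  `exists_conj_mem_autPre_map_autProj_eq`; `ConnectedPart`/`thetaSubquotientStub` form through the fully faithful
  inclusion: `thetaSubquotientStub_lDeltaMap_autProj_conj`, `thetaSubquotientStub_lDeltaMap_isoMk_autProj_conj`).  No Galois
  hypothesis is needed: `g g′ g⁻¹` acts at `x` by the SAME local element as `g′` at `g⁻¹x`.
* **(hpre / hlift / hgeom shapes) at a connected object with a base point `x` relative to a homomorphism `ρ : Γ → Aut E`
  acting at `x` through right translation, `(ρ k)(x) = (φ k)⁻¹ · x`** (the shape of abc-iut-w5-d013's `galoisSurjOf`,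
  `galoisSurjOf_apply_base`; GAP-LEDGER G-w5d123-2 names these laws for `ρ = rhoOfBiKummerData`): `ρ k ∈ autPre` as soon as
  `q (φ k) ∈ L` (`mem_autPre_of_rho_apply_base`), with `autProj (ρ k)` evaluating at `x` to the class of `a`,
  `ι a = q (φ k)⁻¹` (`evalAt_autProj_rho`); every `σ ∈ autPre` IS `ρ` of an element `k` with `q (φ k) ∈ L` when `φ` is
  surjective (`exists_eq_rho_of_mem_autPre`) — so `autPre ≤ ρ(φ⁻¹ q⁻¹ L)` (hgeom shape, `autPre_le_map_rho`) and an element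
  of `autPre` of the form `ρ k₀` lifts to `k ∈ k₀ · φ⁻¹(Stab x)` with `q (φ k) ∈ L` (hlift shape, `exists_lift_of_rho_mem_autPre`);
  `ρ k = 1 ↔ φ k ∈ Stab x` (`rho_eq_one_iff_mem_stabilizer`).
* The same for the canonical Galois surjection `galoisSurjOf hG A hA : Π → Aut A` of a Galois object of `B^temp(Π)`
  (`galoisSurjOf_mem_autPre`, `evalAt_autProj_galoisSurjOf`, `exists_eq_galoisSurjOf_of_mem_autPre`), where `autProj` is ONTO
  (`autProj_surjective_of_isGaloisObj`, for `q` surjective).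

HONEST NOTE (interface, recorded in plan/GAP-LEDGER.md by this seat): abc-iut-L2-t4's FROZEN `FrobenioidCyclotomicRigidity.
ThetaSubquotientProj 𝔉` asks for `proj E : pre E →* lDelta E` SURJECTIVE AT EVERY object `E`; for the R2 carrier `autProj` is onto
only at GALOIS objects (`autProj_surjective_of_normal`), so the pair `⟨autPre, autProj⟩` is packaged as a `ThetaSubquotientProj`
only over Galois objects — which is where every consumer evaluates it (`𝔉.base.obj 𝔉.BN`; the field `proj_surjective` is used by
no declaration in the tree).  Nothing here asserts anything about [EtTh]'s curves; no side taken on [IUTchIII] Cor. 3.12.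
-/

noncomputable section

namespace Literature.AnabelianGeometry.EtaleTheta

namespace ThetaSubquotient

open CategoryTheory Literature.AlgebraicGeometry.Frobenioids Literature.AnabelianGeometry.SemiGraphs
open Literature.AlgebraicGeometry.Frobenioids.QuasiTemperoid (stabilizerSubgroup)
open Literature.AlgebraicGeometry.Frobenioids.QuasiTemperoid.BTempConnected (hom_ρ ρ_mul_apply
  ρ_one_apply ρ_inv_apply ρ_apply_inv exists_ρ_eq_of_isConnectedObj hom_eq_of_apply_eq nonempty_of_isConnectedObj)

universe u v w u'

variable {G : Type u} [Group G] [TopologicalSpace G] {Q : Type v} [Group Q] {Λ : Type w}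
  [CommGroup Λ] (q : G →* Q) (ι : Λ →* Q)

/-! ### `autPre` is normal in `Aut E`; `autProj` is conjugation-equivariant (law hproj, G-w4d099-2) -/

section Conj

variable (E : BTemp G)

/-- `σ (σ⁻¹ x) = x` in `Aut E`. [cite: MochizukiEtTh2009, §5 p.327 (PDF p.101)] -/
theorem aut_apply_inv_apply (σ : Aut E) (x : E.obj.V) :
    (σ.hom.hom.hom (σ⁻¹.hom.hom.hom x) : E.obj.V) = x := by
  rw [← aut_mul_apply, mul_inv_cancel, aut_one_apply]

/-- **The conjugate `g g′ g⁻¹` acts at `x` by the same local element as `g′` at `g⁻¹ x`** (equivariance of `g`).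
[cite: MochizukiEtTh2009, §5 p.327 (PDF p.101)] -/
theorem conj_aut_apply {g g' : Aut E} {x : E.obj.V} {n : G}
    (h : (g'.hom.hom.hom (g⁻¹.hom.hom.hom x) : E.obj.V) = E.obj.ρ n (g⁻¹.hom.hom.hom x)) :
    ((g * g' * g⁻¹).hom.hom.hom x : E.obj.V) = E.obj.ρ n x := by
  rw [aut_mul_apply, aut_mul_apply, h, hom_ρ, aut_apply_inv_apply]

/-- **`autPre E` is normalised by every automorphism of `E`** ("preserved by arbitrary self-equivalences", p.327):
`g′ ∈ autPre ⇒ g g′ g⁻¹ ∈ autPre`, for ANY object `E` of `B^temp(Π)`. [cite: MochizukiEtTh2009, §5 p.327 (PDF p.101)] -/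
theorem conj_mem_autPre (g : Aut E) {g' : Aut E} (h : g' ∈ autPre q ι E) : g * g' * g⁻¹ ∈ autPre q ι E := by
  rw [mem_autPre_iff] at h ⊢
  intro x
  obtain ⟨n, hn, hx⟩ := h (g⁻¹.hom.hom.hom x)
  exact ⟨n, hn, conj_aut_apply E hx⟩

/-- `autPre E` is a normal subgroup of `Aut E`. [cite: MochizukiEtTh2009, §5 p.327 (PDF p.101)] -/
theorem autPre_normal : (autPre q ι E).Normal :=
  ⟨fun _ h g => conj_mem_autPre q ι E g h⟩

variable {E} [ι.range.Normal]

/-- **Conjugation equivariance of `autProj` (law hproj of GAP-LEDGER G-w4d099-2 at the genuine `(Q, P)`)**: for a connected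
`E` and `g ∈ Aut E`, the transport of `(l·Δ_Θ)_E` along `g` takes `autProj g′` to `autProj (g g′ g⁻¹)` — "along an
automorphism of a Galois [here: any connected] covering the induced map on `Aut`-subquotients is conjugation" (proof of
Prop. 5.5, p.328).  Proof: both sides evaluate at `g·x` to the class of the local element of `g′` at `x`
(`evalAt_autProj`, `evalAt_map`), and `evalAt` is injective.  [cite: MochizukiEtTh2009, Prop 5.5 proof p.328 (PDF p.102)] -/
theorem map_autProj_eq_autProj_conj (hE : IsConnectedObj E) (g : Aut E) (σ : autPre q ι E) :
    map q ι hE hE g.hom (autProj q ι E σ) =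
      autProj q ι E ⟨g * (σ : Aut E) * g⁻¹, conj_mem_autPre q ι E g σ.2⟩ := by
  obtain ⟨x⟩ := nonempty_of_isConnectedObj E hE
  obtain ⟨n, ⟨a, ha⟩, hσx⟩ := (mem_autPre_iff q ι E).mp σ.2 x
  apply evalAt_injective q ι hE (g.hom.hom.hom x)
  have h1 : evalAt q ι E (g.hom.hom.hom x) (map q ι hE hE g.hom (autProj q ι E σ)) = QuotientGroup.mk a := by
    rw [evalAt_map, evalAt_autProj q ι E σ x n a ha hσx, proj_mk]
  have hconj : (((g * (σ : Aut E) * g⁻¹ : Aut E)).hom.hom.hom (g.hom.hom.hom x) : E.obj.V) =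
      E.obj.ρ n (g.hom.hom.hom x) := by
    refine conj_aut_apply E ?_
    rw [aut_inv_apply_apply, hσx]
  rw [h1, evalAt_autProj q ι E ⟨_, conj_mem_autPre q ι E g σ.2⟩ (g.hom.hom.hom x) n a ha hconj]

/-- **Law hproj in the binder shape of the consumers** (abc-iut-w5-d020 `cyclotomicRigidity_ofBiKummerData_of_laws` p420788,
abc-iut-w4-d099 `cyclotomicRigidity_ofBiKummerData_connectedPart` p425830, with `Q.lDeltaMap g.hom := map … g.hom`,
`P.pre := autPre`, `P.proj := autProj`): `∃ hgh : g g′ g⁻¹ ∈ autPre, map g (autProj g′) = autProj (g g′ g⁻¹)`.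
[cite: MochizukiEtTh2009, Prop 5.5 proof p.328 (PDF p.102)] -/
theorem exists_conj_mem_autPre_map_autProj_eq (hE : IsConnectedObj E) (g g' : Aut E) (hh : g' ∈ autPre q ι E) :
    ∃ hgh : g * g' * g⁻¹ ∈ autPre q ι E,
      map q ι hE hE g.hom (autProj q ι E ⟨g', hh⟩) = autProj q ι E ⟨g * g' * g⁻¹, hgh⟩ :=
  ⟨conj_mem_autPre q ι E g hh, map_autProj_eq_autProj_conj q ι hE g ⟨g', hh⟩⟩

/-- **Law hproj for abc-iut-L2-t9's instance `thetaSubquotientStub q ι` over `B^temp(Π)⁰`** (automorphisms of the underlying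
`Π`-set `E.obj`, acting on the stub through `ObjectProperty.isoMk`): the stub's transport along `g` takes `autProj g′` to `autProj`
of the conjugate.  [cite: MochizukiEtTh2009, Prop 5.5 proof p.328 (PDF p.102)] -/
theorem thetaSubquotientStub_lDeltaMap_isoMk_autProj_conj (E : ConnectedPart (BTemp G)) (g g' : Aut E.obj)
    (hh : g' ∈ autPre q ι E.obj) :
    ∃ hgh : g * g' * g⁻¹ ∈ autPre q ι E.obj,
      (thetaSubquotientStub q ι).lDeltaMap ((connectedObjects (BTemp G)).isoMk g).hom (autProj q ι E.obj ⟨g', hh⟩) =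
        autProj q ι E.obj ⟨g * g' * g⁻¹, hgh⟩ :=
  exists_conj_mem_autPre_map_autProj_eq q ι E.property g g' hh

/-- **Law hproj for `thetaSubquotientStub q ι`, automorphisms of `B^temp(Π)⁰` through the fully faithful inclusion** (the
plumbing of `Discharge/Sec4GaloisSurjLawsConnectedModel.lean`: an automorphism `g` of the `Π`-set `E.obj` is read in
`Aut_{B^temp(Π)⁰}(E)` as `((connectedObjects _).fullyFaithfulι.autMulEquivOfFullyFaithful E).symm g`, whose underlying arrow is
`g.hom` definitionally): the stub's transport along it takes `autProj g′` to `autProj (g g′ g⁻¹)`.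
[cite: MochizukiEtTh2009, Prop 5.5 proof p.328 (PDF p.102)] -/
theorem thetaSubquotientStub_lDeltaMap_autProj_conj (E : ConnectedPart (BTemp G)) (g g' : Aut E.obj)
    (hh : g' ∈ autPre q ι E.obj) :
    ∃ hgh : g * g' * g⁻¹ ∈ autPre q ι E.obj,
      (thetaSubquotientStub q ι).lDeltaMap
          (((connectedObjects (BTemp G)).fullyFaithfulι.autMulEquivOfFullyFaithful E).symm g).hom
          (autProj q ι E.obj ⟨g', hh⟩) = autProj q ι E.obj ⟨g * g' * g⁻¹, hgh⟩ :=
  exists_conj_mem_autPre_map_autProj_eq q ι E.property g g' hh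

end Conj

/-! ### Laws relative to a homomorphism `ρ : Γ → Aut E` acting at a base point by right translation (G-w5d123-2 shapes) -/

section Rho

variable {E : BTemp G} (x : E.obj.V) {Γ : Type u'} [Group Γ] (φ : Γ →* G) (ρ : Γ →* Aut E)
  (hρ : ∀ k : Γ, ((ρ k).hom.hom.hom x : E.obj.V) = E.obj.ρ (φ k)⁻¹ x)

include hρ

/-- `ρ k` is trivial iff `φ k` stabilises the base point (automorphisms of a connected object are determined at one point).
[cite: MochizukiEtTh2009, Def 4.1 (ii) p.313 (PDF p.87)] -/
theorem rho_eq_one_iff_mem_stabilizer (hE : IsConnectedObj E) (k : Γ) : ρ k = 1 ↔ φ k ∈ stabilizerSubgroup E x := by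
  constructor
  · intro h
    have hx : E.obj.ρ (φ k)⁻¹ x = x := by rw [← hρ k, h, aut_one_apply]
    have h2 := congrArg (E.obj.ρ (φ k)) hx
    rw [ρ_apply_inv] at h2
    exact h2.symm
  · intro h
    refine Iso.ext (hom_eq_of_apply_eq hE _ _ x ?_)
    rw [hρ k, aut_one_apply]
    have h2 := congrArg (E.obj.ρ (φ k)⁻¹) (show E.obj.ρ (φ k) x = x from h)
    rw [ρ_inv_apply] at h2
    exact h2.symm

/-- **Every element of `autPre` is a `ρ k` with `q (φ k) ∈ L`**, when `φ` is surjective: `σ ∈ autPre` acts at `x` by some `n` with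
`q n ∈ L`; take `k` with `φ k = n⁻¹`.  [cite: MochizukiEtTh2009, §5 p.327 (PDF p.101)] -/
theorem exists_eq_rho_of_mem_autPre (hE : IsConnectedObj E) (hφ : Function.Surjective φ) {σ : Aut E}
    (hσ : σ ∈ autPre q ι E) : ∃ k : Γ, q (φ k) ∈ ι.range ∧ ρ k = σ := by
  obtain ⟨n, hn, hx⟩ := (mem_autPre_iff q ι E).mp hσ x
  obtain ⟨k, hk⟩ := hφ n⁻¹
  refine ⟨k, ?_, ?_⟩
  · rw [hk, map_inv]; exact ι.range.inv_mem hn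
  · refine Iso.ext (hom_eq_of_apply_eq hE _ _ x ?_)
    rw [hρ k, hk, inv_inv, hx]

/-- **hgeom shape**: `autPre ≤ ρ(φ⁻¹ q⁻¹ L)` for `φ` surjective — print's "automorphisms given by `l·Δ_Θ`" all come from the
group.  [cite: MochizukiEtTh2009, §5 p.327 (PDF p.101)] -/
theorem autPre_le_map_rho (hE : IsConnectedObj E) (hφ : Function.Surjective φ) :
    autPre q ι E ≤ ((ι.range.comap q).comap φ).map ρ := by
  intro σ hσ
  obtain ⟨k, hk, rfl⟩ := exists_eq_rho_of_mem_autPre q ι x φ ρ hρ hE hφ hσ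
  exact Subgroup.mem_map_of_mem ρ hk

/-- **hlift shape**: an element of `autPre` of the form `ρ k₀` lifts, for `φ` surjective, to `k = k₀ s` with `φ s ∈ Stab x` and
`q (φ k) ∈ L` (so `ρ k = ρ k₀`); if moreover `k₀` lies in a subgroup `H ≤ Γ` containing `φ⁻¹(Stab x)` (print: `Π^tp_{B_N} ≤
Π^tp_Ÿ`), the lift lies in `H`.  [cite: MochizukiEtTh2009, Prop 5.5 proof p.327–328 (PDF pp.101–102)] -/
theorem exists_lift_of_rho_mem_autPre (hE : IsConnectedObj E) (hφ : Function.Surjective φ) (H : Subgroup Γ)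
    (hH : (stabilizerSubgroup E x).comap φ ≤ H) {k₀ : Γ} (hk₀ : k₀ ∈ H) (hm : ρ k₀ ∈ autPre q ι E) :
    ∃ k ∈ H, q (φ k) ∈ ι.range ∧ ρ k = ρ k₀ := by
  obtain ⟨k, hk, hρk⟩ := exists_eq_rho_of_mem_autPre q ι x φ ρ hρ hE hφ hm
  refine ⟨k, ?_, hk, hρk⟩
  -- `k₀⁻¹ k ∈ φ⁻¹(Stab x) ≤ H`
  have h1 : ρ (k₀⁻¹ * k) = 1 := by rw [map_mul, map_inv, hρk, inv_mul_cancel]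
  have h2 : k₀⁻¹ * k ∈ H := hH ((rho_eq_one_iff_mem_stabilizer x φ ρ hρ hE (k₀⁻¹ * k)).mp h1)
  simpa using H.mul_mem hk₀ h2

variable [ι.range.Normal]

/-- **hpre shape**: if `q (φ k) ∈ L` then `ρ k ∈ autPre` (it acts at `x` by `(φ k)⁻¹`, and `L` is normal — so at every point by
a conjugate).  [cite: MochizukiEtTh2009, §5 p.327 (PDF p.101)] -/
theorem mem_autPre_of_rho_apply_base (hE : IsConnectedObj E) (k : Γ) (hk : q (φ k) ∈ ι.range) : ρ k ∈ autPre q ι E :=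
  mem_autPre_of_apply_eq q ι hE x (n := (φ k)⁻¹) (by rw [map_inv]; exact ι.range.inv_mem hk) (hρ k)

/-- **hP shape (point evaluation)**: `autProj (ρ k)` evaluates at the base point to the class of `a` whenever `ι a = q (φ k)⁻¹` —
the composite `φ⁻¹q⁻¹(L) → autPre → (l·Δ_Θ)_E ≅ Λ/J(Stab x)` is `k ↦ [q(φ k)⁻¹]` (the coefficient identification of Prop. 5.5 /
Prop. 5.2 (iii) absorbs the inversion).  [cite: MochizukiEtTh2009, §5 p.327 (PDF p.101)] -/
theorem evalAt_autProj_rho (k : Γ) (a : Λ) (ha : ι a = q (φ k)⁻¹) (hm : ρ k ∈ autPre q ι E) :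
    evalAt q ι E x (autProj q ι E ⟨ρ k, hm⟩) = QuotientGroup.mk a :=
  evalAt_autProj q ι E ⟨ρ k, hm⟩ x (φ k)⁻¹ a ha (hρ k)

end Rho

/-! ### The canonical Galois surjection `galoisSurjOf` of a Galois object of `B^temp(Π)` -/

section GaloisSurj

variable [IsTopologicalGroup G] (hG : IsTempered G) [ι.range.Normal] (A : BTemp G) (hA : IsGaloisObj A)

/-- The Galois surjection acts at abc-iut-w5-d013's base point by right translation (`galoisSurjOf_apply_base`, with `φ = id`).
[cite: MochizukiEtTh2009, Def 4.1 (ii) p.313 (PDF p.87)] -/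
theorem galoisSurjOf_apply_base' (k : G) :
    ((GaloisObjects.galoisSurjOf hG A hA k).hom.hom.hom (GaloisObjects.galoisBase hG A hA) : A.obj.V) =
      A.obj.ρ ((MonoidHom.id G) k)⁻¹ (GaloisObjects.galoisBase hG A hA) :=
  GaloisObjects.galoisSurjOf_apply_base hG A hA k

/-- **hpre for `galoisSurjOf`**: `q k ∈ L ⇒ galoisSurjOf A k ∈ autPre`. [cite: MochizukiEtTh2009, §5 p.327 (PDF p.101)] -/
theorem galoisSurjOf_mem_autPre (k : G) (hk : q k ∈ ι.range) : GaloisObjects.galoisSurjOf hG A hA k ∈ autPre q ι A :=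
  mem_autPre_of_rho_apply_base q ι (GaloisObjects.galoisBase hG A hA) (MonoidHom.id G)
    (GaloisObjects.galoisSurjOf hG A hA) (galoisSurjOf_apply_base' hG A hA) hA.1 k hk

/-- **hP for `galoisSurjOf`** at the base point: `autProj (galoisSurjOf A k)` is the class of `a`, `ι a = q k⁻¹`.
[cite: MochizukiEtTh2009, §5 p.327 (PDF p.101)] -/
theorem evalAt_autProj_galoisSurjOf (k : G) (a : Λ) (ha : ι a = q k⁻¹)
    (hm : GaloisObjects.galoisSurjOf hG A hA k ∈ autPre q ι A) :
    evalAt q ι A (GaloisObjects.galoisBase hG A hA) (autProj q ι A ⟨GaloisObjects.galoisSurjOf hG A hA k, hm⟩) =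
      QuotientGroup.mk a :=
  evalAt_autProj_rho q ι (GaloisObjects.galoisBase hG A hA) (MonoidHom.id G) (GaloisObjects.galoisSurjOf hG A hA)
    (galoisSurjOf_apply_base' hG A hA) k a ha hm

omit [ι.range.Normal] in
/-- **hgeom/hlift for `galoisSurjOf`**: every `σ ∈ autPre A` is `galoisSurjOf A k` for some `k` with `q k ∈ L`.
[cite: MochizukiEtTh2009, §5 p.327 (PDF p.101)] -/
theorem exists_eq_galoisSurjOf_of_mem_autPre {σ : Aut A} (hσ : σ ∈ autPre q ι A) :
    ∃ k : G, q k ∈ ι.range ∧ GaloisObjects.galoisSurjOf hG A hA k = σ :=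
  exists_eq_rho_of_mem_autPre q ι (GaloisObjects.galoisBase hG A hA) (MonoidHom.id G)
    (GaloisObjects.galoisSurjOf hG A hA) (galoisSurjOf_apply_base' hG A hA) hA.1 (fun g => ⟨g, rfl⟩) hσ

end GaloisSurj

section GaloisOnto

variable [IsTopologicalGroup G] [ι.range.Normal]

/-- At a Galois object `autProj` is onto `(l·Δ_Θ)_A` when `q` is surjective (abc-iut-L2-t9's `autProj_surjective_of_normal` at
abc-iut-w5-d013's base point, whose stabiliser is the open normal subgroup `N_A`, `GaloisObjects.ker_galoisSurjOf`).
[cite: MochizukiEtTh2009, §5 p.327 (PDF p.101)] -/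
theorem autProj_surjective_of_isGaloisObj (hG : IsTempered G) (A : BTemp G) (hA : IsGaloisObj A)
    (hq : Function.Surjective q) : Function.Surjective (autProj q ι A) := by
  refine autProj_surjective_of_normal q ι hA.1 hq (GaloisObjects.galoisBase hG A hA) ?_
  have h : stabilizerSubgroup A (GaloisObjects.galoisBase hG A hA) = (GaloisObjects.galoisQuot hG A hA).toSubgroup := by
    ext g
    rw [QuasiTemperoid.mem_stabilizerSubgroup_iff, ← GaloisObjects.mem_ker_galoisSurjOf_iff hG A hA g,
      GaloisObjects.ker_galoisSurjOf]
  rw [h]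
  infer_instance

end GaloisOnto

end ThetaSubquotient

end Literature.AnabelianGeometry.EtaleTheta
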